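import Summits.CriticalPhenomena.PercolationContinuityZ3.Theorems.Transplant.SkelPhiWinChainF2
import Summits.CriticalPhenomena.PercolationContinuityZ3.Theorems.Transplant.SkelPhiWinChainFF
import HarnessLib

/-!
# N2 (frames-only node `SamePDropOfSkeletonFrm₁`, OPEN), (S0) kit tier, Skel side: **THE TWO-WINDOW CHAIN OVER (S0)-SHAPE KITS** — `WinChainData.chainF₂`,
# the `KitsAtF` twin of `WinChainData.chain₂` (SkelPhiWinChainF2)

Two schedule frames `S₁ S₂` read through planar windows `𝒲₁ 𝒲₂` of ONE exploration graph `G'`, same source; per segment the hypotheses of p1-g16's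
`kitsAt_stepAFF` (SkelPhiWinChainFF: subbox regions under `W'`, finite support, source off the regions, level window, count, the per-level clause OF THE
FORCED KIT — the output shape of `kitClauseFC` / `hkits_schedFC` / `hkits_bridgeFC`), nonempty true targets, rim parts inside the regions with rim excess
`≤ η`, and the CROSS LINK `𝒲₁.coreTF S₁ S₁.N ⊆ 𝒲₂.W (S₂.core 0)`.  Conclusion: the concatenated families `stepAF₂` / `coreTF₂` form a linked chain with
`KitsAtF` at every step — the shape `Skel.RootOblTWF` asks.  WHY (J13, design owner p3-g16 2026-08-23): the (R) column's root leg cannot be ONE K-G corridor from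
the pinned seed (the first region always contains the hop's seed: `encl` + `La = n`); as in N1 ((L-R4), `Skel.rootOblTWAt_of_chain₂/₃`) it is HOP → BRIDGE
(one forced-kit step at the bridge pair, N1's `ChainPlanar.bridgeFrame`, clause `hkits_bridgeFC`) → CORRIDOR (`kgCorrSched` in the landing frame), two windows.
builds on p205010 (kernel theorem, internal audit signed; external expert review pending) — nothing in this file uses p205010; nothing here is a claim about
the open node `SamePDropOfSkeletonFrm₁`.
Lane `prim-bschramm`, seat `prim-bschramm-p3` (gen 16; N2 design owner, (R) column owner); helper file (`--supports stmt-CriticalPhenomena-4575 --as helper`).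
[cite: KozmaNitzan2024, §4 Lemma 11 (pp. 22–23), Lemma 12 (pp. 23–25), p. 20 (Step IV), p. 28 ((32) at the root)]
-/

noncomputable section

open MeasureTheory ProbabilityTheory
open scoped ENNReal

namespace Summit.CriticalPhenomena.PercolationContinuityZ3.Theorems.Transplant

namespace Skelφ

open Literature.Probability.Percolation Literature.Probability.LatticeModels SimpleGraph
open Literature.Probability.Percolation.KozmaNitzan
open KNLevels ChainPlanar

variable {V : Type} [DecidableEq V]

namespace WinChainData

variable {G' : SimpleGraph V} [G'.LocallyFinite]
variable (P₁ P₂ : WinChainData V) (𝒲₁ 𝒲₂ : PlanarWindow G') (S₁ S₂ : SchedFrame)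

/-! ## §1 The concatenated families -/

/-! ## The two-window chain over (S0)-shape kits -/

/-- **THE TARGET CHAIN OVER TWO WINDOWS, (S0)-SHAPE KITS** (the `KitsAtF` twin of `chain₂`: per-level FORCED-kit clauses in the shape of
`kitsAt_stepAFF`; design owner p3-g16, for the (R) column's bridge → corridor root leg (J13/(R-36))).  Segment 1: `(P₁, 𝒲₁, S₁)`, segment 2: `(P₂, 𝒲₂, S₂)` in the same exploration graph `G'`, same source;
per segment the hypotheses of `kitsAt_stepAF` at every step (subbox regions under `W'`, finite support, source off the regions, level window, count,
per-level kit clause), nonempty true targets, rim parts inside the regions and rim excess `≤ η`; the CROSS LINK `𝒲₁.coreTF S₁ S₁.N ⊆ 𝒲₂.W (S₂.core 0)`.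
Then the concatenated families `s = stepAF₂`, `T' = coreTF₂` on `Fin (S₁.N + 1 + S₂.N + 1)` form a linked chain with constant source, `T' ⊆ T`,
`KitsAt` at every step, excess `≤ η`, first level `𝒲₁.W (S₁.core 0)` and last true target `𝒲₂.coreTF S₂ S₂.N`.
[cite: KozmaNitzan2024, §4 Lemma 11 (pp. 22–23), Lemma 12 (pp. 23–25), p. 20 (Step IV)] -/
theorem chainF₂ (ho : P₂.o = P₁.o)
    (hRl₁ : P₁.Rlev + 1 ≤ S₁.R') (hRim₁ : ∀ k, P₁.Rim k ⊆ 𝒲₁.stepDF S₁ k) (hTne₁ : ∀ k ≤ S₁.N, (𝒲₁.coreTF S₁ k).Nonempty)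
    (hRl₂ : P₂.Rlev + 1 ≤ S₂.R') (hRim₂ : ∀ k, P₂.Rim k ⊆ 𝒲₂.stepDF S₂ k) (hTne₂ : ∀ k ≤ S₂.N, (𝒲₂.coreTF S₂ k).Nonempty)
    (hx : 𝒲₁.coreTF S₁ S₁.N ⊆ 𝒲₂.W (S₂.core 0))
    {p : unitInterval} {W' : Sym2 V → unitInterval} {Δ' : ℕ} {δ η : ℝ}
    (hsub₁ : ∀ k ≤ S₁.N, IsSubbox G' W' p (𝒲₁.stepDF S₁ k)) (hfin₁ : FinSupp W' P₁.Sfin) (hDS₁ : ∀ k ≤ S₁.N, 𝒲₁.stepDF S₁ k ⊆ P₁.Sfin)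
    (ho₁ : ∀ k ≤ S₁.N, P₁.o ∉ 𝒲₁.stepDF S₁ k) (hoS₁ : P₁.o ∈ P₁.Sfin) (hj₁ : P₁.j₁ ≤ P₁.Rlev)
    (hcount₁ : 1 / (1 - (p : ℝ)) ^ (Δ' * P₁.N) ≤ δ * ((Finset.Icc P₁.j₀ P₁.j₁).card : ℝ))
    (hkits₁ : ∀ k ≤ S₁.N, ∀ j ∈ Finset.Icc P₁.j₀ P₁.j₁, ∃ (σ : SData V) (Sz : Finset V),
      SHyp (P₁.stepLF 𝒲₁ S₁ k) j σ ∧ σ.N ≤ P₁.N ∧ (1 - (p : ℝ) ^ σ.sB) ^ σ.k ≤ δ ∧ Sz ⊆ 𝒲₁.stepDF S₁ k ∧ (∀ x ∈ σ.K, σ.face x ⊆ Sz) ∧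
      RelayClause (P₁.stepLF 𝒲₁ S₁ k) W' j σ Sz (P₁.coreEF 𝒲₁ S₁ k) (𝒲₁.stepDF S₁ k) δ)
    (hexc₁ : ∀ k ≤ S₁.N, (prodBernoulli W').real (⋃ t ∈ P₁.Rim k, openConn P₁.o t) ≤ η)
    (hsub₂ : ∀ k ≤ S₂.N, IsSubbox G' W' p (𝒲₂.stepDF S₂ k)) (hfin₂ : FinSupp W' P₂.Sfin) (hDS₂ : ∀ k ≤ S₂.N, 𝒲₂.stepDF S₂ k ⊆ P₂.Sfin)
    (ho₂ : ∀ k ≤ S₂.N, P₂.o ∉ 𝒲₂.stepDF S₂ k) (hoS₂ : P₂.o ∈ P₂.Sfin) (hj₂ : P₂.j₁ ≤ P₂.Rlev)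
    (hcount₂ : 1 / (1 - (p : ℝ)) ^ (Δ' * P₂.N) ≤ δ * ((Finset.Icc P₂.j₀ P₂.j₁).card : ℝ))
    (hkits₂ : ∀ k ≤ S₂.N, ∀ j ∈ Finset.Icc P₂.j₀ P₂.j₁, ∃ (σ : SData V) (Sz : Finset V),
      SHyp (P₂.stepLF 𝒲₂ S₂ k) j σ ∧ σ.N ≤ P₂.N ∧ (1 - (p : ℝ) ^ σ.sB) ^ σ.k ≤ δ ∧ Sz ⊆ 𝒲₂.stepDF S₂ k ∧ (∀ x ∈ σ.K, σ.face x ⊆ Sz) ∧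
      RelayClause (P₂.stepLF 𝒲₂ S₂ k) W' j σ Sz (P₂.coreEF 𝒲₂ S₂ k) (𝒲₂.stepDF S₂ k) δ)
    (hexc₂ : ∀ k ≤ S₂.N, (prodBernoulli W').real (⋃ t ∈ P₂.Rim k, openConn P₁.o t) ≤ η) :
    let n := S₁.N + 1 + S₂.N
    let s : Fin (n + 1) → TStep G' := fun i => stepAF₂ P₁ P₂ 𝒲₁ 𝒲₂ S₁ S₂ i
    let T' : Fin (n + 1) → Finset V := fun i => coreTF₂ 𝒲₁ 𝒲₂ S₁ S₂ i
    (∀ i : Fin (n + 1), (s i).L.o = P₁.o) ∧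
    (∀ i : Fin n, T' (Fin.castSucc i) ⊆ (s i.succ).L.X 0) ∧ (∀ i : Fin (n + 1), T' i ⊆ (s i).T) ∧
    (∀ i : Fin (n + 1), (s i).KitsAtF W' p Δ' δ) ∧
    (∀ i : Fin (n + 1), (prodBernoulli W').real (⋃ t ∈ (s i).T \ T' i, openConn P₁.o t) ≤ η) ∧
    (s 0).L.X 0 = 𝒲₁.W (S₁.core 0) ∧ T' (Fin.last n) = 𝒲₂.coreTF S₂ S₂.N := by
  intro n s T'
  -- per natural index: the step and target families and their facts, by cases at the cut
  have hfacts : ∀ k ≤ n, coreTF₂ 𝒲₁ 𝒲₂ S₁ S₂ k ⊆ (stepAF₂ P₁ P₂ 𝒲₁ 𝒲₂ S₁ S₂ k).T ∧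
      (stepAF₂ P₁ P₂ 𝒲₁ 𝒲₂ S₁ S₂ k).KitsAtF W' p Δ' δ ∧
      (prodBernoulli W').real (⋃ t ∈ (stepAF₂ P₁ P₂ 𝒲₁ 𝒲₂ S₁ S₂ k).T \ coreTF₂ 𝒲₁ 𝒲₂ S₁ S₂ k, openConn P₁.o t) ≤ η := by
    intro k hk
    by_cases h : k ≤ S₁.N
    · rw [stepAF₂_left _ _ _ _ _ _ h, coreTF₂_left _ _ _ _ h]
      refine ⟨P₁.coreTF_subset_coreEF 𝒲₁ S₁ k, P₁.kitsAt_stepAFF 𝒲₁ S₁ hRl₁ hRim₁ h (hTne₁ k h) (hsub₁ k h) hfin₁ (hDS₁ k h) (ho₁ k h) hoS₁ hj₁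
        hcount₁ (hkits₁ k h), ?_⟩
      refine le_trans (measureReal_mono ?_ (measure_ne_top _ _)) (hexc₁ k h)
      intro ω hω
      simp only [Set.mem_iUnion, exists_prop] at hω ⊢
      obtain ⟨t, ht, hωt⟩ := hω
      exact ⟨t, P₁.coreEF_sdiff_subset 𝒲₁ S₁ k ht, hωt⟩
    · obtain ⟨j, rfl⟩ : ∃ j, k = S₁.N + 1 + j := ⟨k - (S₁.N + 1), by omega⟩
      have hj : j ≤ S₂.N := by change S₁.N + 1 + j ≤ S₁.N + 1 + S₂.N at hk; omega
      rw [stepAF₂_right, coreTF₂_right]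
      refine ⟨P₂.coreTF_subset_coreEF 𝒲₂ S₂ j, P₂.kitsAt_stepAFF 𝒲₂ S₂ hRl₂ hRim₂ hj (hTne₂ j hj) (hsub₂ j hj) hfin₂ (hDS₂ j hj) (ho₂ j hj) hoS₂ hj₂
        hcount₂ (hkits₂ j hj), ?_⟩
      refine le_trans (measureReal_mono ?_ (measure_ne_top _ _)) (hexc₂ j hj)
      intro ω hω
      simp only [Set.mem_iUnion, exists_prop] at hω ⊢
      obtain ⟨t, ht, hωt⟩ := hω
      exact ⟨t, P₂.coreEF_sdiff_subset 𝒲₂ S₂ j ht, hωt⟩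
  -- the links, by cases: inside segment 1, at the frame change, inside segment 2
  have hlinks : ∀ k, k + 1 ≤ n → coreTF₂ 𝒲₁ 𝒲₂ S₁ S₂ k ⊆ (stepAF₂ P₁ P₂ 𝒲₁ 𝒲₂ S₁ S₂ (k + 1)).L.X 0 := by
    intro k hk
    by_cases h : k + 1 ≤ S₁.N
    · rw [coreTF₂_left _ _ _ _ (by omega), stepAF₂_left _ _ _ _ _ _ h]
      exact P₁.coreTF_subset_X_zero_succ 𝒲₁ S₁ k
    · by_cases h' : k = S₁.N
      · subst h'
        rw [coreTF₂_left _ _ _ _ le_rfl, show S₁.N + 1 = S₁.N + 1 + 0 by omega, stepAF₂_right]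
        show 𝒲₁.coreTF S₁ S₁.N ⊆ (P₂.stepLF 𝒲₂ S₂ 0).X 0
        rw [P₂.stepLF_X_zero 𝒲₂ S₂]
        exact hx
      · obtain ⟨j, rfl⟩ : ∃ j, k = S₁.N + 1 + j := ⟨k - (S₁.N + 1), by omega⟩
        rw [coreTF₂_right, show S₁.N + 1 + j + 1 = S₁.N + 1 + (j + 1) by omega, stepAF₂_right]
        exact P₂.coreTF_subset_X_zero_succ 𝒲₂ S₂ j
  have hle : ∀ i : Fin (n + 1), (i : ℕ) ≤ n := fun i => Nat.lt_succ_iff.1 i.2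
  refine ⟨fun i => stepAF₂_o P₁ P₂ 𝒲₁ 𝒲₂ S₁ S₂ ho i, fun i => ?_, fun i => (hfacts i (hle i)).1, fun i => (hfacts i (hle i)).2.1,
    fun i => (hfacts i (hle i)).2.2, ?_, ?_⟩
  · -- the links
    show coreTF₂ 𝒲₁ 𝒲₂ S₁ S₂ (Fin.castSucc i) ⊆ (stepAF₂ P₁ P₂ 𝒲₁ 𝒲₂ S₁ S₂ (i.succ : ℕ)).L.X 0
    have e : ((i.succ : Fin (n + 1)) : ℕ) = (Fin.castSucc i : ℕ) + 1 := by simp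
    rw [e]
    exact hlinks _ (by have := i.2; simp only [Fin.val_castSucc]; omega)
  · -- the first level is the window over the first core of segment 1
    show (stepAF₂ P₁ P₂ 𝒲₁ 𝒲₂ S₁ S₂ ((0 : Fin (n + 1)) : ℕ)).L.X 0 = 𝒲₁.W (S₁.core 0)
    rw [Fin.val_zero, stepAF₂_left _ _ _ _ _ _ (Nat.zero_le _)]
    exact P₁.stepLF_X_zero 𝒲₁ S₁ 0
  · -- the last true target is the last one of segment 2
    show coreTF₂ 𝒲₁ 𝒲₂ S₁ S₂ ((Fin.last n : Fin (n + 1)) : ℕ) = 𝒲₂.coreTF S₂ S₂.N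
    rw [Fin.val_last, show n = S₁.N + 1 + S₂.N from rfl, coreTF₂_right]

end WinChainData

end Skelφ

end Summit.CriticalPhenomena.PercolationContinuityZ3.Theorems.Transplant

end
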